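import Summits.BirchSwinnertonDyer.BirchSwinnertonDyer.Theorems.SignedLowerHalvesSmallImageLowerHalfBothSignsLambdaLowerThreeNsThetaPartnerSerreTheta
import Summits.BirchSwinnertonDyer.BirchSwinnertonDyer.Theorems.SignedLowerHalvesSmallImageLowerHalfBothSignsLambdaLowerThreeNsThetaPartnerOrient
import Literature.NumberTheory.EllipticCurves.SerreInertiaImageBaseChangeProofs
import Literature.NumberTheory.EllipticCurves.HeegnerPointsKolyvaginGoodReductionProofs
import Literature.NumberTheory.EllipticCurves.FrobeniusTraceBaseChange
import Literature.NumberTheory.GaloisRepresentations.HeckeCharacterProofs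
import HarnessLib

/-!
# ORIENTATION (Galois form) OVER THE DIHEDRAL FIELD: `Φ(ρ̄(res_{K/ℚ} res_{K,𝔭} σ)) ↦ θ_{p²−1}(σ)` on the
# inertia group of `K_𝔭` (Serre 1972 §1.11 Prop. 12 b) as a character, read at a place of `K` over `p`)

Route `SignedLowerHalves`, child L `SmallImageLowerHalfBothSigns` (item stmt-BirchSwinnertonDyer-23599), line
proposal `rtt_w3`, stub K0₂@p `stub_heckeThetaPartner_ns` — brick S2 ("ORIENT-G over K") of the arithmetic half
at an ODD prime (width seat `bsd-line-slh-p3-w3` gen 9; memo `Lines/birth_acns-MEMO-w3-g9.md`).  THEOREMS ONLY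
(no definition, no named fact, no `sorry`); ROUTE-INDEPENDENT.

The CM-partner construction at odd `p` reads the inertia action on `E[p]` at the INERT prime `𝔭 = p𝓞_K` of
the dihedral field `K` (where class field theory for `K` lives: `artinCharacter_localGlobalCompatible`,
`coe_lubinTateChar_toAbsGalois` for `K_𝔭`).  This file is the `K`-side form of `…ThetaPartnerOrient`
(`exists_ringHom_apply_eq_fundamentalCharacter`, over `ℚ_v`): for `W/ℚ` globally minimal, `p ≠ 2`, `GoodSS W p`,
a frame `(e, Φ)`, a field `k ⊆ M₂(𝔽_p)` of degree `2` with `Φ(ρ̄(Γ_ℚ)) ≤ N(kˣ)`, a number field `K` whose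
absolute Galois group maps ONTO `U = ρ̄⁻¹(Φ⁻¹(kˣ))` under `res_{K/ℚ} = absGaloisRestrict ℚ K` (hypothesis
`hU : U ≤ range res_{K/ℚ}` — supplied by the dihedral field `K = Fix U`), and a place `v ∣ p` of `K` with
`e(v ∣ p) = 1` (`𝔪_v = p𝓞_v`; e.g. `p` inert in the imaginary quadratic `K`):

* `dvd_eval_dickson_one` — `p ∣ a ⟹ p ∣ D_f(a; p)` for `f ≥ 1` (Dickson polynomial of the first kind), so
  `dvd_frobeniusTraceAt_baseChange`: `p ∣ a_v(W_K)` (tree `frobeniusTraceAt_baseChange_eq_eval_dickson`);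
* `unitGroup_eq_map_absInertia_baseChange` — `kˣ = Φ(ρ̄(res_{K/ℚ}(res_{K,v}(I_{K_v}))))`
  (`…Orient.unitGroup_eq_map_absInertia`-style: `kˣ = Φρ̄(I_𝔔)` at the prime `𝔔` of `\bar ℤ` under the
  completion prime of `v`; `I_𝔔 ≤ U ≤ range res_{K/ℚ}` and `res⁻¹(I_𝔔) = I_𝔓` (`comap_inertia_comap_absIntegersMap`),
  `I_𝔓 = res_{K,v}(I_{K_v})` (`inertia_adicCompletionPrime_eq_map_absInertia`));
* **`exists_ringHom_apply_eq_kummerCharacter_baseChange`** — there is `j : k →+* k'` with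
  `j(Φ(ρ̄(res_{K/ℚ}(res_{K,v} σ)))) = θ_{p²−1}(σ)` for every `σ ∈ I_{K_v}`, `θ_{p²−1}` = the Kummer character of
  the uniformiser `p` of exponent `p² − 1` (= the level-one fundamental character `ψ₁` of `K_v ≅ ℚ_{p²}` when
  `v` is inert).  Proof = the proof of `exists_ringHom_apply_eq_fundamentalCharacter` with Serre's `θ` over
  `K_v` (brick S1 `exists_additive_equivariant_kummer_of_dvd_frobeniusTraceAt`, for `W_K = W ⊗ K` at `v`)
  transported along the equivariant identification `E(ℚ̄) ≃ E_K(K̄)` (`exists_addEquiv_geomPoints_baseChange`).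

BSD, crux L and the stub are NOT proved here.

References: J.-P. Serre, Invent. Math. 15 (1972) §1.7 Prop. 3, §1.11 Prop. 12, §2.2 Prop. 14; J. Neukirch,
ANT Ch. I §9, Ch. II §9 (9.6).
-/

set_option autoImplicit false
set_option linter.dupNamespace false

noncomputable section

open scoped Classical NumberField MatrixGroups
open IsDedekindDomain Field Matrix NumberField WeierstrassCurve Literature.NumberTheory.EllipticCurves
  Literature.NumberTheory.GaloisRepresentations Rat.HeightOneSpectrum
  Literature.NumberTheory.EllipticCurves.Rank1Residual Summit.BirchSwinnertonDyer.Rank1Residual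
  Literature.NumberTheory.GaloisRepresentations.IsNonarchimedeanLocalField
  Literature.NumberTheory.GaloisRepresentations.ModPGaloisRep ValuativeRel
  Literature.NumberTheory.DiophantineGeometry Polynomial

namespace Summit.BirchSwinnertonDyer.BirchSwinnertonDyer.Theorems.SmallImageLambdaLowerThreeNsThetaPartner

universe u

/-! ### §1. `p ∣ a ⟹ p ∣ D_f(a; p)` and `p ∣ a_v(W_K)` -/

/-- `p ∣ a ⟹ p ∣ D_{f}(a; p)` for `f ≥ 1`, `D_f(X; p)` the Dickson polynomial of the first kind
(`D₁ = X`, `D₂ = X² − 2p`, `D_{n+2} = X D_{n+1} − p D_n`). [folklore] -/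
theorem dvd_eval_dickson_one (p a : ℤ) (hpa : p ∣ a) :
    ∀ f : ℕ, 1 ≤ f → p ∣ (Polynomial.dickson 1 p f).eval a := by
  -- strengthened two-step induction: the claim at `f + 1` and `f + 2`
  have key : ∀ f : ℕ, p ∣ (Polynomial.dickson 1 p (f + 1)).eval a ∧ p ∣ (Polynomial.dickson 1 p (f + 2)).eval a := by
    intro f
    induction f with
    | zero =>
      refine ⟨by simpa [Polynomial.dickson_one] using hpa, ?_⟩
      rw [Polynomial.dickson_two, Polynomial.eval_sub, Polynomial.eval_pow, Polynomial.eval_X, Polynomial.eval_mul,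
        Polynomial.eval_C]
      exact dvd_sub (dvd_pow hpa two_ne_zero) (dvd_mul_right p _)
    | succ n ih =>
      refine ⟨ih.2, ?_⟩
      rw [show n + 1 + 2 = n + 1 + 0 + 2 from rfl, Polynomial.dickson_add_two, Polynomial.eval_sub,
        Polynomial.eval_mul, Polynomial.eval_X, Polynomial.eval_mul, Polynomial.eval_C]
      exact dvd_sub (dvd_mul_of_dvd_left hpa _) (dvd_mul_right p _)
  intro f hf
  obtain ⟨f, rfl⟩ := Nat.exists_eq_add_of_le' hf
  exact (key f).1

/-- **`p ∣ a_v(W ⊗ K)`** at a place `v ∣ p` of a number field `K`, for `W/ℚ` with good reduction at `p` and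
`p ∣ a_p(W)`: `a_v(W_K) = D_f(a_p; p)` (tree `frobeniusTraceAt_baseChange_eq_eval_dickson`) with `f = f(v ∣ p) ≥ 1`.
[cite: SilvermanAEC2009, Thm. V.2.3.1] -/
theorem dvd_frobeniusTraceAt_baseChange (W : WeierstrassCurve ℚ) [W.IsElliptic] [W.IsGloballyMinimal]
    (p : ℕ) [Fact p.Prime] (hss : GoodSS W p) (K : Type) [Field K] [NumberField K]
    (v : HeightOneSpectrum (𝓞 K)) (hpv : (p : 𝓞 K) ∈ v.asIdeal) :
    (p : ℤ) ∣ (W.baseChange K).frobeniusTraceAt v := by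
  have hp : p.Prime := Fact.out
  set u : HeightOneSpectrum (𝓞 ℚ) := v.under (𝓞 ℚ) with hudef
  have hpu : (p : 𝓞 ℚ) ∈ u.asIdeal := by
    rw [hudef, HeightOneSpectrum.under_asIdeal, Ideal.under_def, Ideal.mem_comap, map_natCast]
    exact hpv
  have hu : (primesEquiv u : ℕ) = p := primesEquiv_eq_of_natCast_mem hp hpu
  have hgood : W.HasGoodReductionAt u := (hasGoodReductionAtPrime_primesEquiv_iff_holds W u p hu).mp hss.1
  have hw : v.asIdeal.under (𝓞 ℚ) = u.asIdeal := (HeightOneSpectrum.under_asIdeal (𝓞 ℚ) v).symm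
  rw [W.frobeniusTraceAt_baseChange_eq_eval_dickson K hw hgood, W.frobeniusTraceAt_eq_frobeniusTrace u, hu]
  have hres : (u.residueCard : ℤ) = p := by
    rw [Rat.residueCard_eq_natGenerator, show natGenerator u = (primesEquiv u : ℕ) from rfl, hu]
  rw [hres]
  haveI : v.asIdeal.LiesOver u.asIdeal := ⟨hw.symm⟩
  refine dvd_eval_dickson_one (p : ℤ) _ hss.2 _ ?_
  exact Ideal.inertiaDeg_pos v.asIdeal (𝓞 ℚ)

/-! ### §2. The inertia image over `K` is `kˣ` -/

section Curve

variable (W : WeierstrassCurve ℚ) [W.IsElliptic] [W.IsGloballyMinimal] (p : ℕ) [Fact p.Prime]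
  (Φ : Multiplicative (AddAut (geomTorsion W p)) ≃* GL (Fin 2) (ZMod p))

/-- **`kˣ = Φ(ρ̄(res_{K/ℚ}(res_{K,v}(I_{K_v}))))`** for a number field `K` with `U ≤ range res_{K/ℚ}` and a place
`v ∣ p` of `K`: the local inertia group of `K_v`, pushed into `Γ_ℚ`, has image exactly the Cartan subgroup `kˣ`.
[cite: Serre1972, §1.11 Prop. 12 c), §2.2 Prop. 14] [cite: NeukirchANT1999, Ch. II §9 Prop. (9.6)] -/
theorem unitGroup_eq_map_absInertia_baseChange (hp2 : p ≠ 2) (hss : GoodSS W p)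
    {k : Subalgebra (ZMod p) (Matrix (Fin 2) (Fin 2) (ZMod p))} (hk : IsField k)
    (h2 : Module.finrank (ZMod p) k = 2)
    (hGN : (galoisRepTorsion W p).range.map Φ.toMonoidHom ≤
      Subgroup.normalizer (Serre1972.unitGroup k : Set (GL (Fin 2) (ZMod p))))
    (K : Type) [Field K] [NumberField K]
    (hU : ((Serre1972.unitGroup k).comap Φ.toMonoidHom).comap (galoisRepTorsion W p) ≤
      (absGaloisRestrict ℚ K).toMonoidHom.range)
    {v : HeightOneSpectrum (𝓞 K)} (hpv : (p : 𝓞 K) ∈ v.asIdeal) :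
    Serre1972.unitGroup k =
      (absInertia (v.adicCompletion K)).map
        (((Φ.toMonoidHom.comp (galoisRepTorsion W p)).comp (absGaloisRestrict ℚ K).toMonoidHom).comp
          (absGaloisRestrict K (v.adicCompletion K)).toMonoidHom) := by
  have hpP : p.Prime := Fact.out
  have hp3 : 3 ≤ p := by have := hpP.two_le; omega
  -- the place `u` of `ℚ` under `v`, the prime `𝔓` of `\bar ℤ_K` cut out by `K_v`, and its contraction `𝔔`
  set u : HeightOneSpectrum (𝓞 ℚ) := v.under (𝓞 ℚ) with hudef
  have hpu : (p : 𝓞 ℚ) ∈ u.asIdeal := by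
    rw [hudef, HeightOneSpectrum.under_asIdeal, Ideal.under_def, Ideal.mem_comap, map_natCast]
    exact hpv
  have hu : (primesEquiv u : ℕ) = p := primesEquiv_eq_of_natCast_mem hpP hpu
  have hw : v.asIdeal.under (𝓞 ℚ) = u.asIdeal := (HeightOneSpectrum.under_asIdeal (𝓞 ℚ) v).symm
  set 𝔓 : Ideal (absIntegers (𝓞 K) K) := adicCompletionPrime K v with h𝔓def
  set 𝔔 : Ideal (absIntegers (𝓞 ℚ) ℚ) := 𝔓.comap (absIntegersMap ℚ K) with h𝔔def
  have h𝔔 : 𝔔 ∈ u.primesAbove :=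
    comap_absIntegersMap_mem_primesAbove hw (adicCompletionPrime_mem_primesAbove K v)
  -- `kˣ = Φ ρ̄ (I_𝔔)` (Prop. 12 c) + Prop. 14)
  obtain ⟨k', hk', h2', hk'I⟩ :=
    GaloisImage.exists_unitGroup_eq_inertia_image_of_goodSS W p Φ hp2 hss hu h𝔔
  have hC : Serre1972.unitGroup k ∈ Serre1972.cartanSubgroups (ZMod p) :=
    Serre1972.unitGroup_mem_cartanSubgroups hk h2
  have hHle : ((𝔔.inertia (absoluteGaloisGroup ℚ)).map (galoisRepTorsion W p)).map Φ.toMonoidHom ≤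
      (galoisRepTorsion W p).range.map Φ.toMonoidHom :=
    Subgroup.map_mono (fun x ⟨τ, _, hτ⟩ ↦ ⟨τ, hτ⟩)
  have hk'N : Serre1972.unitGroup k' ≤
      Subgroup.normalizer (Serre1972.unitGroup k : Set (GL (Fin 2) (ZMod p))) := by
    rw [← hk'I]; exact hHle.trans hGN
  have hkk : Serre1972.unitGroup k' = Serre1972.unitGroup k :=
    Serre1972.prop14_unitGroup hC hp3 hk' h2' hk'N
  -- `I_𝔔 ≤ U ≤ range res`, so `I_𝔔 = res (I_𝔓)`
  have hIU : 𝔔.inertia (absoluteGaloisGroup ℚ) ≤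
      ((Serre1972.unitGroup k).comap Φ.toMonoidHom).comap (galoisRepTorsion W p) := by
    intro τ hτ
    change Φ (galoisRepTorsion W p τ) ∈ Serre1972.unitGroup k
    rw [← hkk, ← hk'I]
    exact ⟨galoisRepTorsion W p τ, ⟨τ, hτ, rfl⟩, rfl⟩
  have hIres : (𝔓.inertia (absoluteGaloisGroup K)).map (absGaloisRestrict ℚ K).toMonoidHom =
      𝔔.inertia (absoluteGaloisGroup ℚ) := by
    rw [h𝔔def, ← comap_inertia_comap_absIntegersMap ℚ K 𝔓, Subgroup.map_comap_eq]
    exact inf_eq_right.mpr (hIU.trans hU)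
  rw [← hkk, ← hk'I, ← hIres, h𝔓def, inertia_adicCompletionPrime_eq_map_absInertia, Subgroup.map_map,
    Subgroup.map_map, Subgroup.map_map]

/-- For `σ ∈ I_{K_v}`: `Φ(ρ̄(res_{K/ℚ}(res_{K,v} σ))) ∈ kˣ`. [cite: Serre1972, §1.11 Prop. 12 c)] -/
theorem apply_res_res_mem_unitGroup (hp2 : p ≠ 2) (hss : GoodSS W p)
    {k : Subalgebra (ZMod p) (Matrix (Fin 2) (Fin 2) (ZMod p))} (hk : IsField k)
    (h2 : Module.finrank (ZMod p) k = 2)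
    (hGN : (galoisRepTorsion W p).range.map Φ.toMonoidHom ≤
      Subgroup.normalizer (Serre1972.unitGroup k : Set (GL (Fin 2) (ZMod p))))
    (K : Type) [Field K] [NumberField K]
    (hU : ((Serre1972.unitGroup k).comap Φ.toMonoidHom).comap (galoisRepTorsion W p) ≤
      (absGaloisRestrict ℚ K).toMonoidHom.range)
    {v : HeightOneSpectrum (𝓞 K)} (hpv : (p : 𝓞 K) ∈ v.asIdeal) (σ : absInertia (v.adicCompletion K)) :
    Φ (galoisRepTorsion W p (absGaloisRestrict ℚ K (absGaloisRestrict K (v.adicCompletion K)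
        (σ : absoluteGaloisGroup (v.adicCompletion K))))) ∈ Serre1972.unitGroup k := by
  rw [unitGroup_eq_map_absInertia_baseChange W p Φ hp2 hss hk h2 hGN K hU hpv]
  exact ⟨σ, σ.2, rfl⟩

set_option maxHeartbeats 400000 in
/-- **ORIENT-G over the dihedral field** (Serre 1972 §1.11 Prop. 12 b) as a character, at a place of `K`).
`W/ℚ` globally minimal, `p ≠ 2`, `GoodSS W p`, a frame `(e, Φ)` of `E[p]`, a field `k ⊆ M₂(𝔽_p)` of degree `2`
with `Φ(ρ̄(Γ_ℚ)) ≤ N(kˣ)`, a number field `K` with `U ≤ range res_{K/ℚ}`, a place `v ∣ p` of `K` with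
`𝔪_v = p𝓞_v` (`p` a uniformiser of `K_v`), and a residue embedding `ι` into a field `k'`.  Then there is a
ring homomorphism `j : k →+* k'` such that for every `σ` in the inertia group of `K_v`,
`Φ(ρ̄(res_{K/ℚ}(res_{K,v} σ))) ∈ k` and `j` of it is `θ_{p²−1}(σ)`, the Kummer character of `p` of exponent
`p² − 1` (`kummerCharacter K_v (p²−1) p ι`).  [cite: Serre1972, §1.11 Prop. 12 b), §1.10 Prop. 10, §1.7 Prop. 3] -/
theorem exists_ringHom_apply_eq_kummerCharacter_baseChange (hp2 : p ≠ 2) (hss : GoodSS W p)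
    (e : geomTorsion W p ≃+ (Fin 2 → ZMod p))
    (he : ∀ (g : Multiplicative (AddAut (geomTorsion W p))) (x : geomTorsion W p),
      e (Multiplicative.toAdd g x) = ((Φ g : GL (Fin 2) (ZMod p)) : Matrix (Fin 2) (Fin 2) (ZMod p)) *ᵥ e x)
    {k : Subalgebra (ZMod p) (Matrix (Fin 2) (Fin 2) (ZMod p))} (hk : IsField k)
    (h2 : Module.finrank (ZMod p) k = 2)
    (hGN : (galoisRepTorsion W p).range.map Φ.toMonoidHom ≤
      Subgroup.normalizer (Serre1972.unitGroup k : Set (GL (Fin 2) (ZMod p))))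
    (K : Type) [Field K] [NumberField K]
    (hU : ((Serre1972.unitGroup k).comap Φ.toMonoidHom).comap (galoisRepTorsion W p) ≤
      (absGaloisRestrict ℚ K).toMonoidHom.range)
    {v : HeightOneSpectrum (𝓞 K)} (hpv : (p : 𝓞 K) ∈ v.asIdeal)
    (hgen : ∀ c ∈ IsLocalRing.maximalIdeal (v.adicCompletionIntegers K),
      ((p : ℕ) : v.adicCompletionIntegers K) ∣ c)
    {k' : Type} [Field k'] (hirr : Irreducible ((p : ℕ) : 𝒪[v.adicCompletion K])) (hn : 0 < p ^ 2 - 1)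
    (ι : absIntegers 𝒪[v.adicCompletion K] (v.adicCompletion K) ⧸ absMaximalIdeal (v.adicCompletion K) →+* k') :
    ∃ j : k →+* k', ∀ σ : absInertia (v.adicCompletion K),
      ∃ hσ : ((Φ (galoisRepTorsion W p (absGaloisRestrict ℚ K (absGaloisRestrict K (v.adicCompletion K)
          (σ : absoluteGaloisGroup (v.adicCompletion K))))) : GL (Fin 2) (ZMod p)) :
            Matrix (Fin 2) (Fin 2) (ZMod p)) ∈ k,
        j ⟨_, hσ⟩ = (kummerCharacter (v.adicCompletion K) hn hirr.ne_zero ι σ : k') := by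
  have hpP : p.Prime := Fact.out
  -- the base change `W_K`, good and supersingular at `v`
  set WK : WeierstrassCurve K := W.baseChange K with hWK
  haveI : WK.IsElliptic := by rw [hWK, baseChange]; infer_instance
  set u : HeightOneSpectrum (𝓞 ℚ) := v.under (𝓞 ℚ) with hudef
  have hpu : (p : 𝓞 ℚ) ∈ u.asIdeal := by
    rw [hudef, HeightOneSpectrum.under_asIdeal, Ideal.under_def, Ideal.mem_comap, map_natCast]
    exact hpv
  have hu : (primesEquiv u : ℕ) = p := primesEquiv_eq_of_natCast_mem hpP hpu
  have hw : v.asIdeal.under (𝓞 ℚ) = u.asIdeal := (HeightOneSpectrum.under_asIdeal (𝓞 ℚ) v).symm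
  haveI : v.asIdeal.LiesOver u.asIdeal := ⟨hw.symm⟩
  have hgoodu : W.HasGoodReductionAt u := (hasGoodReductionAtPrime_primesEquiv_iff_holds W u p hu).mp hss.1
  have hgood : WK.HasGoodReductionAt v := hasGoodReductionAt_baseChange_of_hasGoodReductionAt_rat W u v hgoodu
  have hssv : (p : ℤ) ∣ WK.frobeniusTraceAt v := dvd_frobeniusTraceAt_baseChange W p hss K v hpv
  -- Serre's `θ` over `K_v` (brick S1) and the equivariant identification `ε : E(ℚ̄) ≃ E_K(K̄)`
  obtain ⟨θ, hθadd, hθinj, hθsmul⟩ :=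
    exists_additive_equivariant_kummer_of_dvd_frobeniusTraceAt WK p hp2 v hpv hgood hssv hgen hirr hn ι
  obtain ⟨ε, hε⟩ := W.exists_addEquiv_geomPoints_baseChange K
  set resK := absGaloisRestrict K (v.adicCompletion K) with hresK
  set res := absGaloisRestrict ℚ K with hres
  set ψ := kummerCharacter (v.adicCompletion K) hn hirr.ne_zero ι with hψ
  -- `ε` maps `E[p]` into `E_K[p]`
  have hεtors : ∀ X : geomTorsion W p, ε (X : geomPoints W) ∈ geomTorsion WK p := by
    intro X
    refine (Submodule.mem_torsionBy_iff _ _).mpr ?_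
    change (p : ℤ) • ε (X : geomPoints W) = 0
    rw [← map_zsmul, show (p : ℤ) • (X : geomPoints W) = 0 from (Submodule.mem_torsionBy_iff _ _).mp X.2,
      map_zero]
  -- the action of `y ∈ M₂(𝔽_p)` on `E[p]` through the frame `e`
  let A : Matrix (Fin 2) (Fin 2) (ZMod p) → geomTorsion W p → geomTorsion W p :=
    fun y X ↦ e.symm (y *ᵥ e X)
  have hA : ∀ y X, e (A y X) = y *ᵥ e X := fun y X ↦ e.apply_symm_apply _
  have hAgal : ∀ (τ : absoluteGaloisGroup ℚ) (X : geomTorsion W p),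
      A ((Φ (galoisRepTorsion W p τ) : GL (Fin 2) (ZMod p)) : Matrix (Fin 2) (Fin 2) (ZMod p)) X =
        Multiplicative.toAdd (galoisRepTorsion W p τ) X := by
    intro τ X; apply e.injective; rw [hA, he]
  have hAadd : ∀ y y' X, A (y + y') X = A y X + A y' X := by
    intro y y' X; apply e.injective; rw [hA, map_add, hA, hA, Matrix.add_mulVec]
  have hAmul : ∀ y y' X, A (y * y') X = A y (A y' X) := by
    intro y y' X; apply e.injective; rw [hA, hA, hA, Matrix.mulVec_mulVec]
  have hAone : ∀ X, A 1 X = X := by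
    intro X; apply e.injective; rw [hA, Matrix.one_mulVec]
  have hAzero : ∀ X, A 0 X = 0 := by
    intro X; apply e.injective; rw [hA, Matrix.zero_mulVec, map_zero]
  -- `Θ = θ ∘ ε` on `E[p]`
  let Θ : geomTorsion W p → k' := fun X ↦ θ (ε (X : geomPoints W))
  have hΘadd : ∀ X Y : geomTorsion W p, Θ (X + Y) = Θ X + Θ Y := by
    intro X Y
    change θ (ε ((X : geomPoints W) + Y)) = _
    rw [map_add]
    exact hθadd _ (hεtors X) _ (hεtors Y)
  have hΘzero : Θ 0 = 0 := by
    have h := hΘadd 0 0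
    rw [add_zero] at h
    exact left_eq_add.mp h
  have hΘinj : ∀ X : geomTorsion W p, Θ X = 0 → X = 0 := by
    intro X hX
    have h1 : ε (X : geomPoints W) = 0 := hθinj _ (hεtors X) hX
    exact Subtype.ext (ε.injective (by rw [h1, ZeroMemClass.coe_zero, map_zero]))
  have hΘsmul : ∀ (σ : absInertia (v.adicCompletion K)) (X : geomTorsion W p),
      Θ (Multiplicative.toAdd (galoisRepTorsion W p (res (resK (σ : absoluteGaloisGroup (v.adicCompletion K))))) X) =
        (ψ σ : k') * Θ X := by
    intro σ X
    have h := hθsmul σ (ε (X : geomPoints W)) (hεtors X)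
    rw [← hε] at h
    simpa only [Θ, galoisRepTorsion_apply, AddSubgroup.torsionBy.coe_smul] using h
  -- a torsion point with `Θ X₀ ≠ 0`
  obtain ⟨X₀, hX₀⟩ : ∃ X₀ : geomTorsion W p, Θ X₀ ≠ 0 := by
    refine ⟨e.symm (fun _ ↦ 1), fun h ↦ ?_⟩
    have h1 := congrArg e (hΘinj _ h)
    rw [e.apply_symm_apply, map_zero] at h1
    exact one_ne_zero (congrFun h1 0)
  have huniq : ∀ (y : Matrix (Fin 2) (Fin 2) (ZMod p)) (c c' : k'),
      (∀ X, Θ (A y X) = c * Θ X) → (∀ X, Θ (A y X) = c' * Θ X) → c = c' := by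
    intro y c c' hc hc'
    exact mul_right_cancel₀ hX₀ ((hc X₀).symm.trans (hc' X₀))
  -- existence of the scalar: `kˣ` is the inertia image over `K`
  have hUk := unitGroup_eq_map_absInertia_baseChange W p Φ hp2 hss hk h2 hGN K hU hpv
  have hexists : ∀ y ∈ k, ∃ c : k', ∀ X, Θ (A y X) = c * Θ X := by
    intro y hy
    by_cases hy0 : y = 0
    · refine ⟨0, fun X ↦ ?_⟩
      rw [hy0, hAzero, zero_mul]; exact hΘzero
    · have hdet : y.det ≠ 0 := Serre1972.det_ne_zero_of_isField hk hy hy0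
      set Y : GL (Fin 2) (ZMod p) := Matrix.GeneralLinearGroup.mkOfDetNeZero y hdet with hYdef
      have hY : Y ∈ Serre1972.unitGroup k := by
        rw [Serre1972.mem_unitGroup_iff]; exact hy
      rw [hUk] at hY
      obtain ⟨σ, hσI, hσ⟩ := hY
      refine ⟨(ψ ⟨σ, hσI⟩ : k'), fun X ↦ ?_⟩
      have hyσ : y = ((Φ (galoisRepTorsion W p (res (resK σ))) : GL (Fin 2) (ZMod p)) :
          Matrix (Fin 2) (Fin 2) (ZMod p)) := by
        have := congrArg (fun g : GL (Fin 2) (ZMod p) ↦ (g : Matrix (Fin 2) (Fin 2) (ZMod p))) hσ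
        simpa [hYdef] using this.symm
      rw [hyσ, hAgal]
      exact hΘsmul ⟨σ, hσI⟩ X
  -- the ring homomorphism
  choose c hc using hexists
  let j₀ : k → k' := fun y ↦ c y.1 y.2
  have hj₀ : ∀ (y : k) X, Θ (A (y : Matrix (Fin 2) (Fin 2) (ZMod p)) X) = j₀ y * Θ X :=
    fun y X ↦ hc y.1 y.2 X
  have hj₀_one : j₀ 1 = 1 :=
    huniq 1 _ _ (hj₀ 1) (fun X ↦ by rw [hAone, one_mul])
  have hj₀_mul : ∀ y y' : k, j₀ (y * y') = j₀ y * j₀ y' := fun y y' ↦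
    huniq _ _ _ (hj₀ (y * y')) (fun X ↦ by
      rw [Subalgebra.coe_mul, hAmul, hj₀ y, hj₀ y', mul_assoc])
  have hj₀_zero : j₀ 0 = 0 :=
    huniq _ _ _ (hj₀ 0) (fun X ↦ by
      have h0 : A ((0 : k) : Matrix (Fin 2) (Fin 2) (ZMod p)) X = 0 := hAzero X
      rw [h0, zero_mul]; exact hΘzero)
  have hj₀_add : ∀ y y' : k, j₀ (y + y') = j₀ y + j₀ y' := fun y y' ↦
    huniq _ _ _ (hj₀ (y + y')) (fun X ↦ by
      rw [Subalgebra.coe_add, hAadd, hΘadd, hj₀ y, hj₀ y', add_mul])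
  let j : k →+* k' :=
    { toFun := j₀, map_one' := hj₀_one, map_mul' := hj₀_mul, map_zero' := hj₀_zero, map_add' := hj₀_add }
  refine ⟨j, fun σ ↦ ?_⟩
  have hσ := apply_res_res_mem_unitGroup W p Φ hp2 hss hk h2 hGN K hU hpv σ
  rw [Serre1972.mem_unitGroup_iff] at hσ
  refine ⟨hσ, ?_⟩
  change j₀ ⟨_, hσ⟩ = _
  exact huniq _ _ _ (hj₀ ⟨_, hσ⟩) (fun X ↦ by rw [hAgal]; exact hΘsmul σ X)

end Curve

end Summit.BirchSwinnertonDyer.BirchSwinnertonDyer.Theorems.SmallImageLambdaLowerThreeNsThetaPartner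

end
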